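import Literature.Computability.AlgebraicComplexity.StrongUSP
import Mathlib.Analysis.Complex.Exponential
import Mathlib.Analysis.SpecialFunctions.Pow.Real
import HarnessLib

/-!
# "The strong USP capacity is achieved by local strong USPs" (Cohn–Kleinberg–Szegedy–Umans 2005, Proposition 6.3 / 34, first sentence)

Topic `Literature/Computability/AlgebraicComplexity` (group-theoretic matrix multiplication).
`StrongUSP.lean` proves the SECOND sentence of CKSU Proposition 6.3 (FOCS) = Proposition 34
(arXiv:math/0511460, §6.1 p. 10) — "given any strong USP `U` of width `k`, there exists a local strong
USP of size `|U|!` and width `|U|k`" (`IsStrongUSP.exists_isLocalStrongUSP`) — and records the FIRST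
sentence as not stated ("the tree has no USP-capacity vocabulary. TODO(general form): strong USP capacity
(CKSU §3) and 'capacity achieved by local strong USPs'").  This file proves that first sentence, AS
PRINTED:

> "**Proposition 6.3.** The strong USP capacity is achieved by local strong USPs. In particular, given
> any strong USP `U` of width `k`, there exists a local strong USP of size `|U|!` and width `|U| k`."

in the `∀ C`-unfolding of CKSU's definition of capacity (§3, arXiv p. 5: "the largest constant `C` such
that there exist strong USPs of size `(C − o(1))^k` and width `k` for infinitely many values of `k`"),
the same unfolding as the tree's `exists_isStrongUSP_card_ge_pow` (`StrongUSPTriangle.lean`, capacity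
`≥ 2^{2/3}`) and `IsStrongUSP.eventually_card_lt_pow` (`USPCapacityUpperBound.lean`, capacity
`≤ 3/2^{2/3}`):

* `exists_isLocalStrongUSP_card_ge_pow_of_strongUSP` — if strong USPs of size `≥ C^k` and width `k`
  exist for arbitrarily large `k`, then for every `0 ≤ C' < C` LOCAL strong USPs of size `≥ C'^{k}` and
  width `k` exist for arbitrarily large `k`.  (So every growth rate achieved by strong USPs is achieved by
  local strong USPs; the converse inequality "local strong USP capacity ≤ strong USP capacity" is
  Lemma 32, `IsLocalStrongUSP.isStrongUSP`, restated in this language as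
  `exists_isStrongUSP_card_ge_pow_of_localStrongUSP`.)

Proof as printed ("In particular …"): blow a strong USP `U` of width `k` and size `s ≥ C^k` up to the
local strong USP of size `s!` and width `sk` of the second sentence; then `(s!)^{1/(sk)} ≥ (s/e)^{1/k} ≥
C · e^{−1/k} ≥ C'` as soon as `(C/C')^k ≥ e`, using the elementary `s^s/s! ≤ e^s`
(`Real.pow_div_factorial_le_exp`) in place of Stirling's formula.

No new definitions, no named facts.

## References
* H. Cohn, R. Kleinberg, B. Szegedy, C. Umans, *Group-theoretic algorithms for matrix multiplication*,
  FOCS 2005, 379–388; arXiv:math/0511460 (Prop. 6.3 = arXiv Prop. 34, §6.1, held text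
  `paper:arxiv-math_0511460` p. 10 L97–L116; capacity definition §3, p. 5 L150–L156).
  [CohnKleinbergSzegedyUmans2005]
-/

namespace Literature.Computability.AlgebraicComplexity

open Real

/-- `s^s ≤ s! · e^s`, i.e. `(s/e)^s ≤ s!` (from `x^n/n! ≤ e^x` at `x = n = s`). [folklore] -/
private theorem pow_div_exp_pow_le_factorial (s : ℕ) :
    ((s : ℝ) / exp 1) ^ s ≤ (s.factorial : ℝ) := by
  have h := Real.pow_div_factorial_le_exp (s : ℝ) (Nat.cast_nonneg s) s
  have hf : (0 : ℝ) < (s.factorial : ℝ) := by exact_mod_cast Nat.factorial_pos s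
  rw [div_pow, exp_one_pow, div_le_iff₀ (exp_pos _)]
  rw [div_le_iff₀ hf] at h
  linarith [mul_comm (s.factorial : ℝ) (exp (s : ℝ))]

/-- **CKSU 2005, Proposition 6.3 / 34, first sentence ("The strong USP capacity is achieved by local
strong USPs"), `∀ C`-unfolding.**  If for arbitrarily large widths `k` there are strong USPs of width `k`
with at least `C^k` rows, then for every `0 ≤ C' < C` and arbitrarily large widths `k` there are LOCAL
strong USPs of width `k` with at least `C'^k` rows — namely (the printed "In particular …") the blow-ups
of size `|U|!` and width `|U| k` of the given strong USPs, since `(|U|!)^{1/(|U|k)} ≥ (|U|/e)^{1/k}`.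
[cite: CohnKleinbergSzegedyUmans2005, Proposition 34 (§6.1, arXiv:math/0511460 p. 10)] -/
theorem exists_isLocalStrongUSP_card_ge_pow_of_strongUSP {C : ℝ}
    (hU : ∀ K : ℕ, ∃ k ≥ K, ∃ s : ℕ, ∃ row : Fin s → Fin k → Fin 3, IsStrongUSP row ∧ C ^ k ≤ (s : ℝ))
    {C' : ℝ} (hC'0 : 0 ≤ C') (hC' : C' < C) (K : ℕ) :
    ∃ k ≥ K, ∃ s : ℕ, ∃ row : Fin s → Fin k → Fin 3, IsLocalStrongUSP row ∧ C' ^ k ≤ (s : ℝ) := by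
  have hCpos : 0 < C := lt_of_le_of_lt hC'0 hC'
  -- a threshold `k₁` with `e ≤ (C/C')^k` for `k ≥ k₁` (any `k₁` if `C' = 0`)
  obtain ⟨k₁, hk₁⟩ : ∃ k₁ : ℕ, ∀ k ≥ k₁, exp 1 * C' ^ k ≤ C ^ k := by
    rcases hC'0.eq_or_lt with h0 | hC'pos
    · refine ⟨1, fun k hk => ?_⟩
      rw [← h0, zero_pow (by omega), mul_zero]
      exact pow_nonneg hCpos.le k
    · have hr : 1 < C / C' := (one_lt_div hC'pos).2 hC'
      obtain ⟨n, hn⟩ := pow_unbounded_of_one_lt (exp 1) hr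
      refine ⟨n, fun k hk => ?_⟩
      have hle : exp 1 ≤ (C / C') ^ k := le_trans hn.le (pow_le_pow_right₀ hr.le hk)
      rw [div_pow, le_div_iff₀ (pow_pos hC'pos k)] at hle
      exact hle
  -- a strong USP of width `k ≥ max K k₁` (and `k ≥ 1`) with `C^k ≤ s`
  obtain ⟨k, hk, s, row, hrow, hs⟩ := hU (max (max K k₁) 1)
  have hkK : K ≤ k := le_trans (le_trans (le_max_left _ _) (le_max_left _ _)) hk
  have hk1 : k₁ ≤ k := le_trans (le_trans (le_max_right _ _) (le_max_left _ _)) hk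
  have hkpos : 1 ≤ k := le_trans (le_max_right _ _) hk
  -- `s ≥ 1` since `C^k > 0`
  have hspos : 1 ≤ s := by
    by_contra h0
    have : s = 0 := by omega
    subst this
    have := lt_of_lt_of_le (pow_pos hCpos k) hs
    simp at this
  -- the blow-up: a local strong USP of size `s!`, width `s * k ≥ k ≥ K`
  obtain ⟨row', hrow'⟩ := hrow.exists_isLocalStrongUSP
  refine ⟨s * k, le_trans hkK (Nat.le_mul_of_pos_left k hspos), s.factorial, row', hrow', ?_⟩
  -- `C'^{sk} = (C'^k)^s ≤ (C^k/e)^s ≤ (s/e)^s ≤ s!`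
  have h1 : C' ^ k ≤ C ^ k / exp 1 := by
    rw [le_div_iff₀ (exp_pos 1), mul_comm]; exact hk₁ k hk1
  have h2 : C ^ k / exp 1 ≤ (s : ℝ) / exp 1 := div_le_div_of_nonneg_right hs (exp_pos 1).le
  calc C' ^ (s * k) = (C' ^ k) ^ s := by rw [mul_comm, pow_mul]
    _ ≤ ((s : ℝ) / exp 1) ^ s := pow_le_pow_left₀ (pow_nonneg hC'0 k) (h1.trans h2) s
    _ ≤ (s.factorial : ℝ) := pow_div_exp_pow_le_factorial s

/-- The converse direction in the same language — **CKSU 2005, Lemma 32 (§6.1): "Every local strong USP is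
a strong USP"**, hence every growth rate achieved by local strong USPs is achieved by strong USPs
(local strong USP capacity `≤` strong USP capacity).
[cite: CohnKleinbergSzegedyUmans2005, Lemma 32 (§6.1, arXiv:math/0511460 p. 10)] -/
theorem exists_isStrongUSP_card_ge_pow_of_localStrongUSP {C : ℝ}
    (hU : ∀ K : ℕ, ∃ k ≥ K, ∃ s : ℕ, ∃ row : Fin s → Fin k → Fin 3, IsLocalStrongUSP row ∧ C ^ k ≤ (s : ℝ))
    (K : ℕ) :
    ∃ k ≥ K, ∃ s : ℕ, ∃ row : Fin s → Fin k → Fin 3, IsStrongUSP row ∧ C ^ k ≤ (s : ℝ) := by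
  obtain ⟨k, hk, s, row, hrow, hs⟩ := hU K
  exact ⟨k, hk, s, row, hrow.isStrongUSP, hs⟩

end Literature.Computability.AlgebraicComplexity
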